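import Summits.BirchSwinnertonDyer.BirchSwinnertonDyer.Theses.ByReductionTypeAtTwo

/-!
# Sketch — crux idea `lemniscate-height-two` (crux-ideate g6-2, `stmt-BirchSwinnertonDyer-19573`)

Crux (fixed, not restated): `Summit.BirchSwinnertonDyer.BirchSwinnertonDyer.Theses.ByReductionTypeAtTwo.OrdKatoHalfAtTwoIso`.

First checkable lemma of the line.  On the auxiliary CM curve `A′/ℚ(i)` (CM by `ℤ[i]`, conductor
`(2+i)²`, GOOD supersingular reduction at the ramified dyadic prime `𝔭 = (1+i)`) the quadratic
Weil self-pairing `q_n(P) := e_{2ⁿ}(P, iP)` maps the height-two Lubin–Tate tower `ℚ₂(i)(A′[𝔭^∞])`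
onto the cyclotomic line `ℚ₂(μ_{2^∞}) = ℚ₂(i)^{cyc}`; the identity below, `q((a + b i)P) = q(P)^{a²+b²}`,
written additively for a general alternating `I`-invariant bilinear form with `I² = −1`, says that the
fibres of `q` are the orbits of the norm-one torus `T¹ ⊂ ℤ₂[i]ˣ` — the anticyclotomic direction — so
that the cyclotomic `χ`-elliptic unit is the TORIC NORM of a unit whose Coleman power series is a
RATIONAL function on `A′` (see the idea card).  Nothing about BSD, the crux, or `μ = 0` is asserted or
proved in this file.
-/

namespace Summit.BirchSwinnertonDyer.BirchSwinnertonDyer.Cruxes.OrdKatoHalfAtTwoIso.LemniscateHeightTwo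

variable {R M : Type*} [CommRing R] [AddCommGroup M] [Module R M]

/-- An alternating bilinear form is antisymmetric. -/
theorem alt_antisymm (e : M →ₗ[R] M →ₗ[R] R) (halt : ∀ x, e x x = 0) (x y : M) :
    e y x = - e x y := by
  have h := halt (x + y)
  simp only [map_add, LinearMap.add_apply, halt, zero_add, add_zero] at h
  linear_combination h

/-- **Weil-norm identity.** For an alternating bilinear form `e` and an endomorphism `I` with
`I² = −1` (the model: the Weil pairing on `A′[2ⁿ]` and `I = [i]`; `I`-invariance of `e` is not even
needed), the quadratic map
`x ↦ e x (I x)` transforms under `a + bI` by the norm `a² + b²`: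
`e ((a + bI)x) (I((a + bI)x)) = (a² + b²) · e x (I x)`.  Hence `q ∘ [α] = q^{N(α)}` for `α ∈ ℤ₂[i]`,
and `q` is constant exactly along orbits of the norm-one torus. -/
theorem weilNorm_quadratic (e : M →ₗ[R] M →ₗ[R] R) (I : M →ₗ[R] M)
    (halt : ∀ x, e x x = 0) (hI : ∀ x, I (I x) = -x) (a b : R) (x : M) :
    e (a • x + b • I x) (I (a • x + b • I x)) = (a ^ 2 + b ^ 2) * e x (I x) := by
  have h2 : e (I x) x = - e x (I x) := alt_antisymm e halt x (I x)
  simp only [map_add, map_smul, map_neg, LinearMap.add_apply, LinearMap.smul_apply,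
    smul_eq_mul, hI, smul_neg, halt, h2, mul_neg, mul_zero, add_zero, zero_add, neg_neg]
  ring

/-- Norm-one elements act trivially on the quadratic map (the torus `T¹` is the fibre direction). -/
theorem weilNorm_torus (e : M →ₗ[R] M →ₗ[R] R) (I : M →ₗ[R] M)
    (halt : ∀ x, e x x = 0) (hI : ∀ x, I (I x) = -x)
    (a b : R) (hab : a ^ 2 + b ^ 2 = 1) (x : M) :
    e (a • x + b • I x) (I (a • x + b • I x)) = e x (I x) := by
  rw [weilNorm_quadratic e I halt hI, hab, one_mul]

/-- Arithmetic of the auxiliary character: `i ≡ 3 (mod 2+i)` and `3` has exact order `4` in `(ℤ/5)ˣ`,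
so there is a (unique) character `χ₅ : (ℤ[i]/(2+i))ˣ → μ₄` restricting to the identity on `μ₄` — the
finite part of the Hecke character `ψ((α)) = χ₅(α)⁻¹ α` of conductor `(2+i)` defining `A′`. -/
example : (3 : ZMod 5) ^ 4 = 1 ∧ (3 : ZMod 5) ^ 2 ≠ 1 := by decide

/-- … whereas conductor `(3)` is impossible: in `(ℤ[i]/3)ˣ ≅ 𝔽₉ˣ` (cyclic of order 8) the class of
`i` is the unique element of order 4, i.e. a square `g²`, so every character with values in `μ₄`
(killing `g⁴ = −1`… ) sends `i` to `±1`, never to `i`: checked as `8 / gcd(8,2) = 4` and `4 ∣ 8/2`. -/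
example : (8 : ℕ) / Nat.gcd 8 2 = 4 ∧ 4 ∣ 8 / 2 := by decide

end Summit.BirchSwinnertonDyer.BirchSwinnertonDyer.Cruxes.OrdKatoHalfAtTwoIso.LemniscateHeightTwo
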